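import Summits.AtomisticToContinuum.HydrodynamicLimit.Theses.StiffCollisionalRelaxation
import Summits.AtomisticToContinuum.HydrodynamicLimit.Theorems.StiffCollisionalRelaxationAprioriBoundsFibreDefs
import Summits.AtomisticToContinuum.HydrodynamicLimit.Theorems.StiffCollisionalRelaxationAprioriBoundsFibreDefsR4
import Summits.AtomisticToContinuum.HydrodynamicLimit.Theorems.StiffCollisionalRelaxationAprioriBoundsOfInBand

/-!
# Crux `AprioriBoundsInBand` (stmt-AtomisticToContinuum-17749) — birth skeleton (BC3), line `birth`

Route `route-AtomisticToContinuum-StiffCollisionalRelaxation` (rank-4 crux since rev 5), sub-problem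
`HydrodynamicLimit`.  Crux decl (route file `Theses/StiffCollisionalRelaxation.lean`, concluded BY NAME below by
`AprioriBoundsInBand_of`): the PROFILE-UNIFORM pre-shock a-priori bounds — `∃ η₁ > 0` (dilute threshold, chosen
BEFORE the profiles) `∀` continuous positive profiles `∃ σ₀ > 0 ∀ σ < σ₀`, for every classical hs-Euler solution on
`[0,T)` matched by the `t = 0` LLN of the local Gibbs laws, every flow family, every `0 < t < T` with `2ρσ³ < η₁`
on `[0,t]`: (i) `∃ λ > 0, C` with `P_N{C < ∫₀ᵗ (N+1)⁻¹∑ᵢ e^{λ|vᵢ(s)|²} ds} → 0` and (ii) for every admissible kernel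
family `∃ c₁ > 0` with `P_N{∃ s ≤ t ∃ x, ρ̄ < c₁ ∨ 1 < ρ̄σ³} → 0`.  The per-profile item `AprioriBounds`
(stmt-14827, `∀ profiles ∃ σ₀ ∃ η₁`) is its corollary (`Theorems.FibreDeficitTransfer.aprioriBounds_of_inBand`,
landed p137831); bodies (i)/(ii) are `AprioriBoundsNegative.PartOneAt` / `PartTwoAt` (landed, definitional).

## The line (in-band transcription of `Cruxes/AprioriBounds/Lines/tail_occupation_variance.lean`, the live
alternative line on 14827 registered by the crux-strategist 2026-08-17; NOT the dead `fibre-deficit-transfer`)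

(i) = SIZE × CONCENTRATION of the time-integrated one-particle tail occupations
`occ_K(z) = ∫₀ᵗ frac_K(Φ_s z) ds ∈ [0,t]` (`frac` landed in `…AprioriBoundsFibreDefs`):
* SIZE in the MEAN, uniformly in the profiles' threshold: `stub_farTailAllInBand` — under the crux prefix WITH
  `∃ η₁` OUTERMOST, `FarTailAllAt` (`E_N occ_K ≤ t·A·e^{−K/(2Θ)}` eventually in `N`, all `K`; landed def in
  `…FibreDefsR4`).  Producer: the pre-shock Gaussian-tail item `UGibbsSRBRigidity.GaussianTails` (stmt-14415)
  through the landed Markov–Tonelli glue `farTailAll_of_gaussianTails` (p137042) — that item has NO dilute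
  premise, so the glue's `η₁` is a free constant and the in-band form costs nothing extra (HighMomentumCutoff
  class: this is where the barrier is paid).
* CONCENTRATION: `stub_occupationVarianceInBand` — under the same in-band prefix, for EVERY FIXED level `K`,
  `Var_{P_N}(occ_K) → 0` (Mathlib `ProbabilityTheory.variance` under the local Gibbs law).  THE load-bearing
  dynamical stub: positive-time self-averaging of deterministic hard spheres at fixed `σ` (pair decorrelation of
  time-averaged tail sojourns of two tagged spheres, by exchangeability); no identification of any limit, hence
  NOT hydrodynamics in the mean (the conjunct-strength input `stub_linStatL1` at which `fibre-deficit-transfer`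
  died, `Lines/fibre-deficit-transfer-dead.md` §2) and not implied by / implying (i).
* (ii) imported: `stub_cellBoundsInBand` — component (ii) under the in-band prefix.  Producer:
  `GermanoSplitLES.KineticRangeControl` (stmt-9201, a `∀ η₀ > 0 ∀ profiles ∃ σ₀ …` statement) by the landed glue
  `AdiabatCeiling.partTwo_of_kineticRangeControl` (p121015), whose threshold is the CONSTANT `η₁ := 2` chosen
  independently of the profiles — so the same proof gives the in-band form (move `refine ⟨2, two_pos, …⟩` first).
* GLUE, byte-identical with stubs 4–5 of the 14827 line (one proof serves both cruxes; provable now, M / M–L):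
  `stub_occupationInProb_of_variance` (Chebyshev at each level: `Var → 0` + mean bound ⇒ in-probability Gaussian
  profile of the occupations) and `stub_partOne_of_occupation` (the λ-dial / layer cake / Markov on the geometric
  top ⇒ `PartOneAt`; template the landed `Theorems.FibreDeficitTransfer.stub_partOnePrime`).
`AprioriBoundsInBand_of` (sorry-free, ~25 lines of quantifier bookkeeping): `η₁ := min η₁⁽ⁱⁱ⁾ (min η₁ᶠᵃʳ η₁ᵛᵃʳ)`
outermost, `σ₀ := min (min σ₁ (min σ₂ σ₃)) (1/2)` per profile (`σ ≤ 1/2` makes the local Gibbs laws probability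
measures, the hypothesis of the two glue stubs), the dilute premise is monotone in the threshold, then
`PartOneAt ∧ PartTwoAt` is the crux body definitionally.

Why the uniformity of 17749 (its only delta over 14827) does not bite this cut: each open input's threshold is an
EOS-free constant (`2` for (ii) via 9201; free for the far tails via 14415; the variance stub has `η₁` outermost by
fiat and is true at equilibrium for every `η₁`), exactly the situation the route header foresaw ("whose lines prove
17749 verbatim when their thresholds are EOS constants").

## BC3 audit (planner `planner-skel-stmt-AtomisticToContinuum-17749-0`, 2026-08-17)
`lean check --json birth.lean`: rc 0, errors [], sorries = 5 = the five `Holds.stub_*` (zero elsewhere;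
`AprioriBoundsInBand_of`, `partOneInBand_of`, `aprioriBoundsInBand_iff` sorry-free).  Probes (folder `bc/`): for
each of the 5 stubs `S`, `example : S → AprioriBoundsInBand` and `example : S → _root_.HydrodynamicLimit` by
`first | exact? | simpa | aesop` FAIL (10/10) — no stub is cheaply the crux or the summit.

## Disproof used (`Cruxes/AprioriBounds/Disproof.lean`, standing disprover of the per-profile twin 14827, cycle 4,
unchanged since 2026-08-16T12:30Z; no `Cruxes/AprioriBoundsInBand/Disproof.lean` exists yet)
§3/§3d `aprioriBoundsII_false_without_small_sigma` (+ `Negative/WithoutSmallSigma`): (ii) needs `σ` small —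
honoured, `∃ σ₀` per profile in stubs 1–3 and `σ ≤ 1/2` in stubs 4–5; §4d/§9e `aprioriBoundsPreShockAllLambda_false`
(+ `Negative/AllLambda`, `Negative/CriticalLambda`: `λ < 1/(2θ₀)` on the rung): the `∀ λ` strengthening is false —
honoured, `λ` is produced INSIDE `PartOneAt` (after the profiles) by the dial of stub 5 below `1/(2 max(Θ,Θ'))`;
§7–§8 `AprioriBounds_false_of_PersistentHotSpot` / `…_of_PersistentVacuum` (landed `Negative/*`) need `t ≥ T` —
every stub carries the pre-shock binder `t < T`; the landed witness `AprioriBoundsNegative.expMoment_bounds_not_sufficient`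
(`Theorems/…AprioriBoundsExpectationGap.lean`: bounds in the MEAN never give the fixed-`C` form of (i)) is exactly
what stub 3 adds to stub 2.  Equilibrium unit test of stub 3 (true for every flow family: i.i.d. Maxwellian
velocities given positions under the invariant homogeneous law, `Var occ_K ≤ t²/(4(N+1))`) as in the 14827 card.
-/

noncomputable section

open MeasureTheory ProbabilityTheory Filter Set Topology
open scoped ENNReal

namespace Summit.AtomisticToContinuum.HydrodynamicLimit.Cruxes.AprioriBoundsInBand.Birth

open Literature.MathematicalPhysics.KineticTheory Literature.Analysis.FluidPDE
open Summit.AtomisticToContinuum.HydrodynamicLimit.Theorems.AprioriBoundsNegative (PartOneAt PartTwoAt)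
open Summit.AtomisticToContinuum.HydrodynamicLimit.Theorems.VisitLedgerUpscattering (Cfg Flow Flows NiceProfiles)
open Summit.AtomisticToContinuum.HydrodynamicLimit.Theorems.FibreDeficitTransfer

/-! ## The crux in (i)/(ii) vocabulary (definitional, sorry-free) -/

/-- `AprioriBoundsInBand` unfolded: the in-band prefix, then `PartOneAt ∧ PartTwoAt`. -/
theorem aprioriBoundsInBand_iff :
    Summit.AtomisticToContinuum.HydrodynamicLimit.Theses.StiffCollisionalRelaxation.AprioriBoundsInBand ↔
      ∃ η₁ : ℝ, 0 < η₁ ∧ ∀ (a₀ θ₀ : T3 → ℝ) (u₀ : T3 → V3), Continuous a₀ → Continuous θ₀ → Continuous u₀ →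
        (∀ x, 0 < a₀ x) → (∀ x, 0 < θ₀ x) →
        ∃ σ₀ : ℝ, 0 < σ₀ ∧ ∀ σ : ℝ, 0 < σ → σ < σ₀ →
          ∀ (T : ℝ) (ρ θ : ℝ → T3 → ℝ) (u : ℝ → T3 → V3), IsHardSphereEulerSolution σ T ρ u θ →
          ∀ Φ : (N : ℕ) → HardSphereFlow (Torus.geometry (Fin 3)) (hsDiameter σ N) (N + 1),
            TendstoHydroFieldsAt (fun N => localGibbsLaw σ a₀ u₀ θ₀ N (Φ N)) Φ ρ u θ 0 →
            ∀ t : ℝ, 0 < t → t < T → (∀ s ∈ Icc 0 t, ∀ x, 2 * ρ s x * σ ^ 3 < η₁) →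
              PartOneAt σ a₀ θ₀ u₀ Φ t ∧ PartTwoAt σ a₀ θ₀ u₀ Φ t :=
  Iff.rfl

/-! ## Registered stubs (bodies `sorry`; signatures over LANDED vocabulary only: `frac` (`…AprioriBoundsFibreDefs`),
`FarTailAllAt` (`…FibreDefsR4`), `PartOneAt` / `PartTwoAt` (`…AprioriBounds.Negative.EquilibriumRung`), `NiceProfiles`
(`…VisitLedgerDefs`), Mathlib's `ProbabilityTheory.variance`) -/

namespace Holds

/-- STUB 1 `cellBoundsInBand` (OPEN, import — component (ii) under the IN-BAND prefix `∃ η₁` outermost).  Producer: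
`GermanoSplitLES.KineticRangeControl` (stmt-9201) by the landed glue `AdiabatCeiling.partTwo_of_kineticRangeControl`
(its threshold is the constant `η₁ := 2`, profile-free).  Why it might fail: no dynamical anti-clustering / no-cavitation
estimate for hard spheres at fixed `σ` is known even pre-shock (9201's own why-might-fail). -/
theorem stub_cellBoundsInBand :
    ∃ η₁ : ℝ, 0 < η₁ ∧ ∀ (a₀ θ₀ : T3 → ℝ) (u₀ : T3 → V3), Continuous a₀ → Continuous θ₀ → Continuous u₀ →
      (∀ x, 0 < a₀ x) → (∀ x, 0 < θ₀ x) →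
      ∃ σ₀ : ℝ, 0 < σ₀ ∧ ∀ σ : ℝ, 0 < σ → σ < σ₀ →
        ∀ (T : ℝ) (ρ θ : ℝ → T3 → ℝ) (u : ℝ → T3 → V3), IsHardSphereEulerSolution σ T ρ u θ →
        ∀ Φ : (N : ℕ) → HardSphereFlow (Torus.geometry (Fin 3)) (hsDiameter σ N) (N + 1),
          TendstoHydroFieldsAt (fun N => localGibbsLaw σ a₀ u₀ θ₀ N (Φ N)) Φ ρ u θ 0 →
          ∀ t : ℝ, 0 < t → t < T → (∀ s ∈ Icc 0 t, ∀ x, 2 * ρ s x * σ ^ 3 < η₁) →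
            PartTwoAt σ a₀ θ₀ u₀ Φ t := by
  sorry

/-- STUB 2 `farTailAllInBand` (OPEN, import — the SIZE input under the IN-BAND prefix: far tails at ALL levels in the
MEAN, `FarTailAllAt`: `E_N ∫₀ᵗ frac_K ds ≤ t·A·e^{−K/(2Θ)}` eventually in `N`, for all `K`).  Producer: the PRE-SHOCK
tail item `UGibbsSRBRigidity.GaussianTails` (stmt-14415, no dilute premise ⇒ `η₁` free) through the landed glue
`farTailAll_of_gaussianTails` (p137042).  Why it might fail: HighMomentumCutoff barrier — no Gaussian velocity moment is
known along the deterministic flow at fixed `σ`, even in the mean. -/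
theorem stub_farTailAllInBand :
    ∃ η₁ : ℝ, 0 < η₁ ∧ ∀ (a₀ θ₀ : T3 → ℝ) (u₀ : T3 → V3), Continuous a₀ → Continuous θ₀ → Continuous u₀ →
      (∀ x, 0 < a₀ x) → (∀ x, 0 < θ₀ x) →
      ∃ σ₀ : ℝ, 0 < σ₀ ∧ ∀ σ : ℝ, 0 < σ → σ < σ₀ →
        ∀ (T : ℝ) (ρ θ : ℝ → T3 → ℝ) (u : ℝ → T3 → V3), IsHardSphereEulerSolution σ T ρ u θ →
        ∀ Φ : (N : ℕ) → HardSphereFlow (Torus.geometry (Fin 3)) (hsDiameter σ N) (N + 1),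
          TendstoHydroFieldsAt (fun N => localGibbsLaw σ a₀ u₀ θ₀ N (Φ N)) Φ ρ u θ 0 →
          ∀ t : ℝ, 0 < t → t < T → (∀ s ∈ Icc 0 t, ∀ x, 2 * ρ s x * σ ^ 3 < η₁) →
            FarTailAllAt σ a₀ θ₀ u₀ Φ t := by
  sorry

/-- STUB 3 `occupationVarianceInBand` (OPEN — THE NEW LOAD-BEARING DYNAMICAL STUB, the CONCENTRATION input, under the
IN-BAND prefix).  For EVERY FIXED level `K`, the variance under the local Gibbs law of the time-integrated one-particle
tail occupation `occ_K(z) = ∫₀ᵗ frac_K(Φ_s z) ds ∈ [0, t]` tends to `0` as `N → ∞`.  No rate, no uniformity in `K`, no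
identification of the limit of the mean; by exchangeability it is PAIR DECORRELATION of the time-averaged tail sojourns of
two tagged spheres.  TRUE at equilibrium for every flow family (`Var occ_K ≤ t²/(4(N+1))`).  Why it might fail: a
positive-time self-averaging statement for deterministic hard spheres at fixed `σ`, known only in the Boltzmann–Grad
limit for short times; an `N`-independent macroscopic randomness of the far tails before `T` (the shape of the landed
witness `expMoment_bounds_not_sufficient`) would break it. -/
theorem stub_occupationVarianceInBand :
    ∃ η₁ : ℝ, 0 < η₁ ∧ ∀ (a₀ θ₀ : T3 → ℝ) (u₀ : T3 → V3), Continuous a₀ → Continuous θ₀ → Continuous u₀ →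
      (∀ x, 0 < a₀ x) → (∀ x, 0 < θ₀ x) →
      ∃ σ₀ : ℝ, 0 < σ₀ ∧ ∀ σ : ℝ, 0 < σ → σ < σ₀ →
        ∀ (T : ℝ) (ρ θ : ℝ → T3 → ℝ) (u : ℝ → T3 → V3), IsHardSphereEulerSolution σ T ρ u θ →
        ∀ Φ : (N : ℕ) → HardSphereFlow (Torus.geometry (Fin 3)) (hsDiameter σ N) (N + 1),
          TendstoHydroFieldsAt (fun N => localGibbsLaw σ a₀ u₀ θ₀ N (Φ N)) Φ ρ u θ 0 →
          ∀ t : ℝ, 0 < t → t < T → (∀ s ∈ Icc 0 t, ∀ x, 2 * ρ s x * σ ^ 3 < η₁) →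
            ∀ K : ℝ, Tendsto (fun N : ℕ => variance
              (fun z => (∫⁻ s in Icc 0 t, ENNReal.ofReal (frac K ((Φ N).flow s z))).toReal)
              (localGibbsLaw σ a₀ u₀ θ₀ N (Φ N))) atTop (𝓝 0) := by
  sorry

/-- STUB 4 `occupationInProb_of_variance` (PROVABLE NOW, M — Chebyshev at each level; BYTE-IDENTICAL with stub 4 of the
14827 line `tail-occupation-variance`).  For `0 < σ ≤ 1/2` (local Gibbs laws are probability measures,
`isProbabilityMeasure_localGibbsLaw`), nice profiles, `t > 0`, any flow family: vanishing variances of the occupations and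
far tails in the mean (`FarTailAllAt`) give the IN-PROBABILITY GAUSSIAN PROFILE OF THE TIME-INTEGRATED OCCUPATIONS at
every level with the SAME `Θ, A`: `P_N{ tAe^{−K/(2Θ)} + η < occ_K } → 0` for all `K` and all `η > 0`
(`occ_K` measurable and bounded by `t`: `HardSphereFlow.measurable_flow_prod_torus`, `measurable_frac`, `frac_mem_Icc`;
`E occ_K ≤ tAe^{−K/(2Θ)}` for `N ≥ N₀`; `ProbabilityTheory.meas_ge_le_variance_div_sq`). -/
theorem stub_occupationInProb_of_variance :
    ∀ (σ : ℝ) (a₀ θ₀ : T3 → ℝ) (u₀ : T3 → V3)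
      (Φ : (N : ℕ) → HardSphereFlow (Torus.geometry (Fin 3)) (hsDiameter σ N) (N + 1)) (t : ℝ),
      0 < σ → σ ≤ 1 / 2 → NiceProfiles a₀ θ₀ u₀ → 0 < t →
      (∀ K : ℝ, Tendsto (fun N : ℕ => variance
          (fun z => (∫⁻ s in Icc 0 t, ENNReal.ofReal (frac K ((Φ N).flow s z))).toReal)
          (localGibbsLaw σ a₀ u₀ θ₀ N (Φ N))) atTop (𝓝 0)) →
      FarTailAllAt σ a₀ θ₀ u₀ Φ t →
        ∃ Θ A : ℝ, 0 < Θ ∧ ∀ K : ℝ, ∀ η : ℝ, 0 < η →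
          Tendsto (fun N : ℕ => localGibbsLaw σ a₀ u₀ θ₀ N (Φ N)
            {z | t * A * Real.exp (-(K / (2 * Θ))) + η <
              (∫⁻ s in Icc 0 t, ENNReal.ofReal (frac K ((Φ N).flow s z))).toReal}) atTop (𝓝 0) := by
  sorry

/-- STUB 5 `partOne_of_occupation` (PROVABLE NOW, M–L — the dial; BYTE-IDENTICAL with stub 5 of the 14827 line).  For
`0 < σ ≤ 1/2`, nice profiles, `t > 0`: the in-probability Gaussian profile of the occupations (constants `Θ', A'`) and
`FarTailAllAt` (constants `Θ, A`) give `PartOneAt`: `λ := 1/(4 max(Θ,Θ'))`; layer cake over integer levels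
`(N+1)⁻¹∑ᵢ e^{λ|vᵢ|²} ≤ ∑_{K∈ℕ} e^{λ(K+1)} frac_K`, Tonelli, `Cexp := ∑_K e^{λ(K+1)} tA'e^{−K/(2Θ')} + 1`; Markov on
the levels `K > M` from `FarTailAllAt`, the finitely many bad events of stub 4 below `M`; template the landed
`Theorems.FibreDeficitTransfer.stub_partOnePrime` / `partOne_markov_step`. -/
theorem stub_partOne_of_occupation :
    ∀ (σ : ℝ) (a₀ θ₀ : T3 → ℝ) (u₀ : T3 → V3)
      (Φ : (N : ℕ) → HardSphereFlow (Torus.geometry (Fin 3)) (hsDiameter σ N) (N + 1)) (t : ℝ),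
      0 < σ → σ ≤ 1 / 2 → NiceProfiles a₀ θ₀ u₀ → 0 < t →
      (∃ Θ A : ℝ, 0 < Θ ∧ ∀ K : ℝ, ∀ η : ℝ, 0 < η →
          Tendsto (fun N : ℕ => localGibbsLaw σ a₀ u₀ θ₀ N (Φ N)
            {z | t * A * Real.exp (-(K / (2 * Θ))) + η <
              (∫⁻ s in Icc 0 t, ENNReal.ofReal (frac K ((Φ N).flow s z))).toReal}) atTop (𝓝 0)) →
      FarTailAllAt σ a₀ θ₀ u₀ Φ t → PartOneAt σ a₀ θ₀ u₀ Φ t := by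
  sorry

end Holds

/-! ## Stub statements by name (the hypotheses of the skeleton theorem are these, BY NAME) -/

/-- Statement of registered stub 1 (`Holds.stub_cellBoundsInBand`). -/
def stub_cellBoundsInBand : Prop := type_of% Holds.stub_cellBoundsInBand
/-- Statement of registered stub 2 (`Holds.stub_farTailAllInBand`). -/
def stub_farTailAllInBand : Prop := type_of% Holds.stub_farTailAllInBand
/-- Statement of registered stub 3 (`Holds.stub_occupationVarianceInBand`). -/
def stub_occupationVarianceInBand : Prop := type_of% Holds.stub_occupationVarianceInBand
/-- Statement of registered stub 4 (`Holds.stub_occupationInProb_of_variance`). -/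
def stub_occupationInProb_of_variance : Prop := type_of% Holds.stub_occupationInProb_of_variance
/-- Statement of registered stub 5 (`Holds.stub_partOne_of_occupation`). -/
def stub_partOne_of_occupation : Prop := type_of% Holds.stub_partOne_of_occupation

/-! ## Compositions (sorry-free) -/

/-- Component (i) under the IN-BAND prefix from stubs 3 (concentration), 2 (size), 4 (Chebyshev), 5 (dial):
`η₁ := min η₃ η₂` OUTERMOST, then per profile `σ₀ := min (min σ₃ σ₂) (1/2)`. -/
theorem partOneInBand_of (h3 : stub_occupationVarianceInBand) (h2 : stub_farTailAllInBand)
    (h4 : stub_occupationInProb_of_variance) (h5 : stub_partOne_of_occupation) :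
    ∃ η₁ : ℝ, 0 < η₁ ∧ ∀ (a₀ θ₀ : T3 → ℝ) (u₀ : T3 → V3), Continuous a₀ → Continuous θ₀ → Continuous u₀ →
      (∀ x, 0 < a₀ x) → (∀ x, 0 < θ₀ x) →
      ∃ σ₀ : ℝ, 0 < σ₀ ∧ ∀ σ : ℝ, 0 < σ → σ < σ₀ →
        ∀ (T : ℝ) (ρ θ : ℝ → T3 → ℝ) (u : ℝ → T3 → V3), IsHardSphereEulerSolution σ T ρ u θ →
        ∀ Φ : (N : ℕ) → HardSphereFlow (Torus.geometry (Fin 3)) (hsDiameter σ N) (N + 1),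
          TendstoHydroFieldsAt (fun N => localGibbsLaw σ a₀ u₀ θ₀ N (Φ N)) Φ ρ u θ 0 →
          ∀ t : ℝ, 0 < t → t < T → (∀ s ∈ Icc 0 t, ∀ x, 2 * ρ s x * σ ^ 3 < η₁) →
            PartOneAt σ a₀ θ₀ u₀ Φ t := by
  obtain ⟨η₃, hη₃, H3⟩ := (h3 : type_of% Holds.stub_occupationVarianceInBand)
  obtain ⟨η₂, hη₂, H2⟩ := (h2 : type_of% Holds.stub_farTailAllInBand)
  have H4 : type_of% Holds.stub_occupationInProb_of_variance := h4
  have H5 : type_of% Holds.stub_partOne_of_occupation := h5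
  refine ⟨min η₃ η₂, lt_min hη₃ hη₂, ?_⟩
  intro a₀ θ₀ u₀ ha hθ hu ha0 hθ0
  have hP : NiceProfiles a₀ θ₀ u₀ := ⟨ha, hθ, hu, ha0, hθ0⟩
  obtain ⟨σ₃, hσ₃, K3⟩ := H3 a₀ θ₀ u₀ ha hθ hu ha0 hθ0
  obtain ⟨σ₂, hσ₂, K2⟩ := H2 a₀ θ₀ u₀ ha hθ hu ha0 hθ0
  refine ⟨min (min σ₃ σ₂) (1 / 2), lt_min (lt_min hσ₃ hσ₂) one_half_pos, ?_⟩
  intro σ hσ hσlt T ρ θ u hsol Φ hLLN t ht htT hdil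
  simp only [lt_min_iff] at hσlt hdil
  obtain ⟨⟨hs3, hs2⟩, hshalf⟩ := hσlt
  have hVar := K3 σ hσ hs3 T ρ θ u hsol Φ hLLN t ht htT (fun s hs x => (hdil s hs x).1)
  have hFar : FarTailAllAt σ a₀ θ₀ u₀ Φ t :=
    K2 σ hσ hs2 T ρ θ u hsol Φ hLLN t ht htT (fun s hs x => (hdil s hs x).2)
  have hOcc := H4 σ a₀ θ₀ u₀ Φ t hσ hshalf.le hP ht hVar hFar
  exact H5 σ a₀ θ₀ u₀ Φ t hσ hshalf.le hP ht hOcc hFar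

/-- **THE SKELETON THEOREM.**  The five registered stubs (1 `cellBoundsInBand`, 2 `farTailAllInBand`,
3 `occupationVarianceInBand` OPEN; 4, 5 provable now) imply the crux decl
`StiffCollisionalRelaxation.AprioriBoundsInBand` BY NAME: `η₁ := min η₁⁽ⁱ⁾ η₁⁽ⁱⁱ⁾` outermost, `σ₀ := min σ₀⁽ⁱ⁾ σ₀⁽ⁱⁱ⁾`
per profile, the dilute premise is monotone in the threshold, and the body is `PartOneAt ∧ PartTwoAt` definitionally. -/
theorem AprioriBoundsInBand_of (h1 : stub_cellBoundsInBand) (h2 : stub_farTailAllInBand)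
    (h3 : stub_occupationVarianceInBand) (h4 : stub_occupationInProb_of_variance)
    (h5 : stub_partOne_of_occupation) :
    Summit.AtomisticToContinuum.HydrodynamicLimit.Theses.StiffCollisionalRelaxation.AprioriBoundsInBand := by
  rw [aprioriBoundsInBand_iff]
  obtain ⟨ηI, hηI, HI⟩ := partOneInBand_of h3 h2 h4 h5
  obtain ⟨ηII, hηII, HII⟩ := (h1 : type_of% Holds.stub_cellBoundsInBand)
  refine ⟨min ηI ηII, lt_min hηI hηII, ?_⟩
  intro a₀ θ₀ u₀ ha hθ hu ha0 hθ0
  obtain ⟨σ₁, hσ₁, K1⟩ := HI a₀ θ₀ u₀ ha hθ hu ha0 hθ0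
  obtain ⟨σ₂, hσ₂, K2⟩ := HII a₀ θ₀ u₀ ha hθ hu ha0 hθ0
  refine ⟨min σ₁ σ₂, lt_min hσ₁ hσ₂, ?_⟩
  intro σ hσ hσlt T ρ θ u hsol Φ hLLN t ht htT hdil
  simp only [lt_min_iff] at hσlt hdil
  exact ⟨K1 σ hσ hσlt.1 T ρ θ u hsol Φ hLLN t ht htT (fun s hs x => (hdil s hs x).1),
    K2 σ hσ hσlt.2 T ρ θ u hsol Φ hLLN t ht htT (fun s hs x => (hdil s hs x).2)⟩

/-- D-0027 §3.3 shape: the crux from the registered stubs (modulo exactly the five `sorry`s). -/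
example : Summit.AtomisticToContinuum.HydrodynamicLimit.Theses.StiffCollisionalRelaxation.AprioriBoundsInBand :=
  AprioriBoundsInBand_of Holds.stub_cellBoundsInBand Holds.stub_farTailAllInBand Holds.stub_occupationVarianceInBand
    Holds.stub_occupationInProb_of_variance Holds.stub_partOne_of_occupation

/-- What the skeleton also closes: the per-profile twin `AprioriBounds` (stmt-14827) and its `CollisionIsometryCLT`
copy, through the landed `aprioriBounds_of_inBand`. -/
example (h1 : stub_cellBoundsInBand) (h2 : stub_farTailAllInBand) (h3 : stub_occupationVarianceInBand)
    (h4 : stub_occupationInProb_of_variance) (h5 : stub_partOne_of_occupation) :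
    Summit.AtomisticToContinuum.HydrodynamicLimit.Theses.StiffCollisionalRelaxation.AprioriBounds :=
  aprioriBounds_of_inBand (AprioriBoundsInBand_of h1 h2 h3 h4 h5)

end Summit.AtomisticToContinuum.HydrodynamicLimit.Cruxes.AprioriBoundsInBand.Birth

end
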